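import Summits.RiemannHypothesis.RiemannHypothesis.Theorems.TiltedLandingLaw421R3RateCapital

/-! # TiltedLandingLaw421R3RateFarC — W-08 RATE^B BOOKS: §B.10 the c-SCALED far energy law (OPTIONAL add-on, C4 g28 (CA371)(2) CONSTANT NOTE)
The provable far step (`…R3FarStep` #1045 + C4 farStep-v2 §F.6 / C3 g38 (T3)) gives `(4/5)·s² ≤ η²·ΔE` across a charged far level, not constant 1:
`FarEnergyLawCQ c` (T, OPEN; `c = 1` ↔ `FarEnergyLawQ`), `farLawQ_of_energyLawC_rises` (K: purse and rise allowance scaled by `c⁻¹`), the nodes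
`restRateBotQ_of_energyLawC`, `law421_of_energyLawC` (K).
Typed ≠ proved: laws marked (T, OPEN) are HYPOTHESES measured by the engines; (K) lemmas are bookkeeping about MODEL sockets; nothing here bears on the
truth of RH; RH is NOT proved; 24774 OPEN. -/

namespace RhW08.SealSwapQ

open Complex
open RhIdea6.G17.W07C7 RhIdea6.G17.W07C7.Rev6 RhIdea6.G18.W07C8.Law421BirthS RhIdea6.G19.W07C11.Seam
open RhIdea6.G20.W07C12.Frac RhIdea6.G20.W07C12.StColP RhW07.C12.FieldSplit RhIdea6.G21.W07C13.TentMax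
open RhW07.C14.TwoSided RhW07.C14.Classes RhW07.C14.Lineage RhW07.C14.Booking
open RhW07.C13.Heredity RhIdea6.G22.W07C15pre.Injection RhW07.E3.Cell
open RhW07.E3.Lit
open RhW08.Round1 RhW08.StSwap RhW08.Round2 RhW08.QuadW
open RhW08.SealSwap (PBot)

/-! ## §B.10 (CA371)(2) THE c-SCALED FAR ENERGY LAW — the provable far step gives `(4/5)·s² ≤ η²·ΔE` (`RhW08.FarStep.far_step_energy_eta`, C3 g38
(T3): exact floor `2√2 − 2`), not constant 1; the books take the law with ANY constant `c > 0` and scale the energy purse and the rise allowance by `c⁻¹`. -/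

/-- (T, OPEN) §B.10 the **c-SCALED FAR-HOVER ENERGY LAW**: across a charged far level `c·s² ≤ η²·(lowH_j² − lowH_{j+1}²)` (`c = 1` is `FarEnergyLawQ`;
the far step of `…R3FarStep` delivers `c = 4/5` once its one-point field hypotheses are discharged on the frame). -/
def FarEnergyLawCQ (c : ℝ) : Prop :=
  ∀ (η : ℝ) (f : ℂ → ℂ) (x₀ s hmax R Hs : ℝ) (B : ℕ), EngineHyps5 2 η f x₀ s hmax R Hs B →
    ∀ j : ℕ, Charged (PTrkSQ PBot) StTrkDQ ReadyR2 η f x₀ s hmax R Hs B j → FarLevelQ η f x₀ s hmax R Hs B j →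
      c * s ^ 2 ≤ η ^ 2 * (lowH StTrkDQ η f x₀ s hmax R Hs B j ^ 2 - lowH StTrkDQ η f x₀ s hmax R Hs B (j + 1) ^ 2)

/-- (K) §B.10 `c = 1` is the books' `FarEnergyLawQ`. -/
theorem farEnergyLawCQ_one : FarEnergyLawCQ 1 ↔ FarEnergyLawQ := by
  simp only [FarEnergyLawCQ, FarEnergyLawQ, one_mul]

/-- (K) §B.10 the law is monotone in the constant. -/
theorem farEnergyLawCQ_mono {c c' : ℝ} (hcc : c' ≤ c) (h : FarEnergyLawCQ c) : FarEnergyLawCQ c' := by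
  intro η f x₀ s hmax R Hs B hE j hj hfar
  have := h η f x₀ s hmax R Hs B hE j hj hfar
  nlinarith [sq_nonneg s]

/-- §B.10 a budget scaled by a constant. -/
def scaleBudgetQ (t : ℝ) (a : Budget) : Budget := fun η f x₀ s hmax R Hs B => t * a η f x₀ s hmax R Hs B

/-- (K) §B.10 prefix sums are linear in a constant factor. -/
theorem prefixSumQ_const_mul (t : ℝ) (ρ : LevelMeter) (η : ℝ) (f : ℂ → ℂ) (x₀ s hmax R Hs : ℝ) (B k : ℕ) :
    prefixSumQ (fun η f x₀ s hmax R Hs B j => t * ρ η f x₀ s hmax R Hs B j) η f x₀ s hmax R Hs B k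
      = t * prefixSumQ ρ η f x₀ s hmax R Hs B k := by
  simp only [prefixSumQ, Finset.mul_sum]

/-- ★★★ (K) §B.10 **(R2)_c + RISE ALLOWANCE ⟹ (P2)** with the purse and the rise allowance scaled by `c⁻¹`:
`FarEnergyLawCQ c → EnergyRiseLawQ aR → FarLawQ (c⁻¹·energyPurseQ + c⁻¹·aR)` (potential `η²·lowH²/(c·s²)`; `c = 1` is `farLawQ_of_energyLaw_rises`). -/
theorem farLawQ_of_energyLawC_rises {c : ℝ} {aR : Budget} (hc : 0 < c) (hR2 : FarEnergyLawCQ c) (hr : EnergyRiseLawQ aR) :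
    FarLawQ (addBudget (scaleBudgetQ c⁻¹ energyPurseQ) (scaleBudgetQ c⁻¹ aR)) := by
  have hci : 0 ≤ c⁻¹ := inv_nonneg.mpr hc.le
  refine classLawQ_of_potential_rises
    (fun η f x₀ s hmax R Hs B k => c⁻¹ * (η ^ 2 * lowH StTrkDQ η f x₀ s hmax R Hs B k ^ 2 / s ^ 2))
    (fun η f x₀ s hmax R Hs B j => c⁻¹ *
      max (η ^ 2 * lowH StTrkDQ η f x₀ s hmax R Hs B (j + 1) ^ 2 / s ^ 2 - η ^ 2 * lowH StTrkDQ η f x₀ s hmax R Hs B j ^ 2 / s ^ 2) 0) ?_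
  intro η f x₀ s hmax R Hs B hE
  have hs : 0 < s := hE.2.2.2.1
  have hs2 : 0 < s ^ 2 := by positivity
  refine ⟨fun k => by positivity, le_of_eq rfl, fun k hk => ?_, ?_⟩
  · rw [prefixSumQ_const_mul]
    exact mul_le_mul_of_nonneg_left (hr η f x₀ s hmax R Hs B hE k hk) hci
  intro k _
  have hmx := le_max_left (η ^ 2 * lowH StTrkDQ η f x₀ s hmax R Hs B (k + 1) ^ 2 / s ^ 2
      - η ^ 2 * lowH StTrkDQ η f x₀ s hmax R Hs B k ^ 2 / s ^ 2) 0
  have hρ0 : 0 ≤ c⁻¹ * max (η ^ 2 * lowH StTrkDQ η f x₀ s hmax R Hs B (k + 1) ^ 2 / s ^ 2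
      - η ^ 2 * lowH StTrkDQ η f x₀ s hmax R Hs B k ^ 2 / s ^ 2) 0 := mul_nonneg hci (le_trans (le_refl _) (le_max_right _ _))
  have hlin : c⁻¹ * (η ^ 2 * lowH StTrkDQ η f x₀ s hmax R Hs B (k + 1) ^ 2 / s ^ 2)
      - c⁻¹ * (η ^ 2 * lowH StTrkDQ η f x₀ s hmax R Hs B k ^ 2 / s ^ 2)
      ≤ c⁻¹ * max (η ^ 2 * lowH StTrkDQ η f x₀ s hmax R Hs B (k + 1) ^ 2 / s ^ 2
          - η ^ 2 * lowH StTrkDQ η f x₀ s hmax R Hs B k ^ 2 / s ^ 2) 0 := by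
    rw [← mul_sub]; exact mul_le_mul_of_nonneg_left hmx hci
  by_cases hj : Charged (PTrkSQ PBot) StTrkDQ ReadyR2 η f x₀ s hmax R Hs B k ∧ FarLevelQ η f x₀ s hmax R Hs B k
  · rw [if_pos hj]
    have hE2 := hR2 η f x₀ s hmax R Hs B hE k hj.1 hj.2
    have hl0 : 0 ≤ lowH StTrkDQ η f x₀ s hmax R Hs B k := RhW08.StSwap.lowH_nonneg _ _ _ _ _ _ _ _ _ _
    have hl1 : 0 ≤ lowH StTrkDQ η f x₀ s hmax R Hs B (k + 1) := RhW08.StSwap.lowH_nonneg _ _ _ _ _ _ _ _ _ _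
    have hcs : 0 < c * s ^ 2 := mul_pos hc hs2
    have hEd : lowH StTrkDQ η f x₀ s hmax R Hs B (k + 1) ^ 2 < lowH StTrkDQ η f x₀ s hmax R Hs B k ^ 2 := by
      have hη : 0 ≤ η ^ 2 := sq_nonneg η
      by_contra hle
      rw [not_lt] at hle
      have : η ^ 2 * (lowH StTrkDQ η f x₀ s hmax R Hs B k ^ 2 - lowH StTrkDQ η f x₀ s hmax R Hs B (k + 1) ^ 2) ≤ 0 :=
        mul_nonpos_of_nonneg_of_nonpos hη (by linarith)
      linarith
    have hld : lowH StTrkDQ η f x₀ s hmax R Hs B (k + 1) < lowH StTrkDQ η f x₀ s hmax R Hs B k :=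
      lt_of_pow_lt_pow_left₀ 2 hl0 hEd
    have hd : 0 ≤ 4 * dropQ η f x₀ s hmax R Hs B k / s := div_nonneg (by unfold dropQ; linarith) hs.le
    have key : 1 ≤ c⁻¹ * (η ^ 2 * (lowH StTrkDQ η f x₀ s hmax R Hs B k ^ 2 - lowH StTrkDQ η f x₀ s hmax R Hs B (k + 1) ^ 2) / s ^ 2) := by
      rw [inv_mul_eq_div, le_div_iff₀ hc, one_mul, le_div_iff₀ hs2]
      exact hE2
    have hre : c⁻¹ * (η ^ 2 * lowH StTrkDQ η f x₀ s hmax R Hs B k ^ 2 / s ^ 2)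
        - c⁻¹ * (η ^ 2 * lowH StTrkDQ η f x₀ s hmax R Hs B (k + 1) ^ 2 / s ^ 2)
        = c⁻¹ * (η ^ 2 * (lowH StTrkDQ η f x₀ s hmax R Hs B k ^ 2 - lowH StTrkDQ η f x₀ s hmax R Hs B (k + 1) ^ 2) / s ^ 2) := by
      ring
    linarith
  · rw [if_neg hj, add_zero]
    linarith

/-- ★★★ (K) §B.10 **THE c-FUNDED NODE**: `FarEnergyLawCQ c` + `EnergyRiseLawQ aR` + (C) + the capital-funded residual approach allowance ⟹ `RestRateBotQ`. -/
theorem restRateBotQ_of_energyLawC {c : ℝ} {aR aC : Budget} (hc : 0 < c) (hR2 : FarEnergyLawCQ c) (hr : EnergyRiseLawQ aR)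
    (hC : ConsLawQ aC)
    (hA : ApproachAllowanceQ (residualBudgetQ (addBudget (scaleBudgetQ c⁻¹ energyPurseQ) (scaleBudgetQ c⁻¹ aR)) aC)) : RestRateBotQ :=
  restRateBotQ_of_capitalFunded (farLawQ_of_energyLawC_rises hc hR2 hr) hC hA

/-- ★★★ (K) §B.10 … and with the first stub, the crux. -/
theorem law421_of_energyLawC (hS : RestSuccBotQ) {c : ℝ} {aR aC : Budget} (hc : 0 < c) (hR2 : FarEnergyLawCQ c)
    (hr : EnergyRiseLawQ aR) (hC : ConsLawQ aC)
    (hA : ApproachAllowanceQ (residualBudgetQ (addBudget (scaleBudgetQ c⁻¹ energyPurseQ) (scaleBudgetQ c⁻¹ aR)) aC)) :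
    Summit.RiemannHypothesis.RiemannHypothesis.Theses.EarlyAppointments.TiltedLandingLaw421 :=
  law421T_of_succ_rateQ hS (restRateBotQ_of_energyLawC hc hR2 hr hC hA)

end RhW08.SealSwapQ
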